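import Literature.Analysis.FluidPDE.NSWeakProductRule
import Literature.Analysis.FluidPDE.SereginSverakLocalHolderTools
import Literature.Analysis.FluidPDE.ClassicalSuitable
import HarnessLib

/-!
# Bounded distributional Navier–Stokes solutions solve the Stokes system with force `-(∇u) u`

Analysis/FluidPDE proof file on the decomposition path of the named fact
`Literature.Analysis.FluidPDE.SereginSverak2009.LocalHolderBound`
(`FluidPDE/SereginSverakBlowup`; Seregin–Šverák 2009, §4, arXiv:0804.1803 p. 11: "Now, we can
interpret the pair `u^k` and `p^k` as a solution to the nonhomogeneous Stokes system (p12)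
`∂ₜu^k - Δu^k + ∇p^k = f^k`, `div u^k = 0` in `Q(3a)`, where `f^k = -u^k·∇u^k`"). On a ball-based
cylinder `Q = ]t₀ - R², t₀[ × B(x₀, R)`:

* `setIntegral_inner_convect_eq_neg` — for a distributional Navier–Stokes pair `(u, p)` on `Q`
  with `|u| ≤ M` a.e. and a weak spatial gradient `G = ∇u` integrable on `Q`,
  `∫∫_Q ⟪u, (u·∇)ψ⟫ = -∫∫_Q ⟪G u, ψ⟫` for every test field `ψ` on `Q` (slice-wise the weak product
  rule of `FluidPDE/NSWeakProductRule`, the slices having weak gradient `G(t, ·)` for a.e. `t`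
  by `FluidPDE/WeakGradientSlicing` and vanishing trace by
  `SerrinBoundedHolder.ae_trace_eq_zero`; then Fubini);
* `isDistributionalStokesSolutionOn_of_isDistributionalNSSolutionOn` — consequently `(u, p)` is
  a distributional solution of the Stokes system (accepted `IsDistributionalStokesSolutionOn` of
  `FluidPDE/SereginLocalStokesRegularity`) with the force `f = -(G u) ∈ L¹(Q)`.

## References

* G. Seregin, V. Šverák, Comm. PDE 34 (2009) = arXiv:0804.1803, §4 p. 11, (p12).
  [`SereginSverak2009`]
-/

noncomputable section

open MeasureTheory TopologicalSpace Set Function Metric Filter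
open scoped Laplacian InnerProductSpace RealInnerProductSpace ENNReal NNReal Topology

namespace Literature.Analysis.FluidPDE

/-! ## From the Navier–Stokes identity to the Stokes system with force `-(∇u) u` -/

section ConvSpaceTime

open FunctionSpaces SerrinBoundedHolder

/-- Local notation for physical space `ℝ³ = EuclideanSpace ℝ (Fin 3)`. -/
local notation "ℝ³" => EuclideanSpace ℝ (Fin 3)

/-- Local notation for the standard basis vectors of `ℝ³`. -/
local notation "𝐞" j => EuclideanSpace.single (j : Fin 3) (1 : ℝ)

/-- The slices of a space–time test field on the cylinder `]t₀-R², t₀[ × B(x₀, R)` are test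
fields on the ball. [folklore] -/
theorem isTestFunctionOn_slice_of_parabolicCylinder {z : ℝ × ℝ³} {R : ℝ} {ψ : ℝ → ℝ³ → ℝ³}
    (hψ : IsSpaceTimeTestOn (parabolicCylinderOpens R z) ψ) (t : ℝ) :
    IsTestFunctionOn (⟨ball z.2 R, isOpen_ball⟩ : Opens ℝ³) (ψ t) := by
  refine ⟨hψ.contDiff_slice t, hψ.hasCompactSupport_slice t, fun x hx => ?_⟩
  by_contra hxB
  have hz : (t, x) ∉ tsupport (uncurry ψ) := by
    intro h
    have h' := hψ.tsupport_subset h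
    rw [coe_parabolicCylinderOpens, mem_parabolicCylinder] at h'
    exact hxB (mem_ball.2 h'.2)
  exact notMem_tsupport_slice_of_notMem hz hx

variable {z : ℝ × ℝ³} {R M : ℝ} {u : ℝ → ℝ³ → ℝ³} {p : ℝ → ℝ³ → ℝ} {G : ℝ → ℝ³ → ℝ³ →L[ℝ] ℝ³}

/-- A field essentially bounded on a cylinder and locally integrable there is integrable on
the cylinder (finite measure). [folklore] -/
theorem integrableOn_parabolicCylinder_of_bound
    (hu : LocallyIntegrableOn (uncurry u) (parabolicCylinder R z) volume)
    (hM : ∀ᵐ w ∂(volume.restrict (parabolicCylinder R z)), ‖u w.1 w.2‖ ≤ M) :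
    IntegrableOn (uncurry u) (parabolicCylinder R z) volume := by
  haveI := isFiniteMeasure_restrict_parabolicCylinder R z
  exact Integrable.mono' (integrable_const M) hu.aestronglyMeasurable hM

/-- Integrability of the convective integrand `⟪u, (u·∇)ψ⟫` on the cylinder for bounded `u`.
[folklore] -/
theorem integrableOn_inner_convect
    (hu : LocallyIntegrableOn (uncurry u) (parabolicCylinder R z) volume)
    (hM : ∀ᵐ w ∂(volume.restrict (parabolicCylinder R z)), ‖u w.1 w.2‖ ≤ M)
    {ψ : ℝ → ℝ³ → ℝ³} (hψ : IsSpaceTimeTestOn (parabolicCylinderOpens R z) ψ) :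
    IntegrableOn (fun w : ℝ × ℝ³ => ⟪u w.1 w.2, convect (u w.1) (ψ w.1) w.2⟫)
      (parabolicCylinder R z) volume := by
  have hum : AEStronglyMeasurable (uncurry u) (volume.restrict (parabolicCylinder R z)) :=
    hu.aestronglyMeasurable
  have huI := integrableOn_parabolicCylinder_of_bound hu hM
  have hDc : Continuous fun w : ℝ × ℝ³ => fderiv ℝ (ψ w.1) w.2 := hψ.continuous_fderiv_slice
  have hD0 : ∀ w ∉ tsupport (uncurry ψ), fderiv ℝ (ψ w.1) w.2 = 0 := fun w hw =>
    image_eq_zero_of_notMem_tsupport fun h' =>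
      notMem_tsupport_slice_of_notMem hw (tsupport_fderiv_subset ℝ h')
  obtain ⟨CD, hCD⟩ :=
    hDc.bounded_above_of_compact_support (HasCompactSupport.intro hψ.hasCompactSupport hD0)
  refine Integrable.mono' (huI.norm.mul_const (CD * M))
    (hum.inner (aestronglyMeasurable_clm_apply_fin3 hDc.aestronglyMeasurable hum)) ?_
  filter_upwards [hM] with w hw
  rw [convect_apply]
  exact (norm_inner_le_norm _ _).trans (mul_le_mul_of_nonneg_left
    ((ContinuousLinearMap.le_opNorm _ _).trans
      (mul_le_mul (hCD w) hw (norm_nonneg _) ((norm_nonneg _).trans (hCD w)))) (norm_nonneg _))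

/-- Integrability of `⟪(∇u) u, ψ⟫` on the cylinder for bounded `u` with integrable gradient.
[folklore] -/
theorem integrableOn_inner_gradient_apply
    (hu : LocallyIntegrableOn (uncurry u) (parabolicCylinder R z) volume)
    (hM : ∀ᵐ w ∂(volume.restrict (parabolicCylinder R z)), ‖u w.1 w.2‖ ≤ M)
    (hGI : IntegrableOn (uncurry G) (parabolicCylinder R z) volume)
    {ψ : ℝ → ℝ³ → ℝ³} (hψ : IsSpaceTimeTestOn (parabolicCylinderOpens R z) ψ) :
    IntegrableOn (fun w : ℝ × ℝ³ => ⟪G w.1 w.2 (u w.1 w.2), ψ w.1 w.2⟫)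
      (parabolicCylinder R z) volume := by
  have hum : AEStronglyMeasurable (uncurry u) (volume.restrict (parabolicCylinder R z)) :=
    hu.aestronglyMeasurable
  have hψc : Continuous (uncurry ψ) := hψ.contDiff.continuous
  obtain ⟨Cψ, hCψ⟩ := hψc.bounded_above_of_compact_support hψ.hasCompactSupport
  refine Integrable.mono' ((hGI.norm.mul_const M).mul_const Cψ)
    ((aestronglyMeasurable_clm_apply_fin3 hGI.aestronglyMeasurable hum).inner
      hψc.aestronglyMeasurable) ?_
  filter_upwards [hM] with w hw
  calc ‖⟪G w.1 w.2 (u w.1 w.2), ψ w.1 w.2⟫‖ ≤ ‖G w.1 w.2 (u w.1 w.2)‖ * ‖ψ w.1 w.2‖ :=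
        norm_inner_le_norm _ _
    _ ≤ ‖uncurry G w‖ * M * Cψ := by
        refine mul_le_mul ?_ (hCψ w) (norm_nonneg _)
          (mul_nonneg (norm_nonneg _) ((norm_nonneg _).trans hw))
        calc ‖G w.1 w.2 (u w.1 w.2)‖ ≤ ‖G w.1 w.2‖ * ‖u w.1 w.2‖ :=
              ContinuousLinearMap.le_opNorm _ _
          _ ≤ ‖uncurry G w‖ * M := mul_le_mul_of_nonneg_left hw (norm_nonneg _)

/-- **The convective term through the weak gradient.** For a distributional Navier–Stokes
solution on a cylinder `Q = ]t₀-R², t₀[ × B(x₀, R)` with a weak spatial gradient `G = ∇u`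
integrable on `Q` and `|u| ≤ M` a.e., `∫∫_Q ⟪u, (u·∇)ψ⟫ = -∫∫_Q ⟪(∇u) u, ψ⟫` for every test field
`ψ` on `Q`: slice-wise this is `setIntegral_inner_fderiv_apply_self_eq_neg` (the slices
`u(t,·)` have weak gradient `G(t,·)` for a.e. `t`, `FluidPDE/WeakGradientSlicing`, and
`tr G = 0` a.e. by the weak divergence-free condition, `SerrinBoundedHolder.ae_trace_eq_zero`),
and the slices are integrated by Fubini. [folklore] -/
theorem setIntegral_inner_convect_eq_neg
    (hNS : IsDistributionalNSSolutionOn (parabolicCylinderOpens R z) 1 0 u p)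
    (hG : HasWeakSpatialGradientOn (parabolicCylinderOpens R z) u G) (hM0 : 0 ≤ M)
    (hM : ∀ᵐ w ∂(volume.restrict (parabolicCylinder R z)), ‖u w.1 w.2‖ ≤ M)
    (hGI : IntegrableOn (uncurry G) (parabolicCylinder R z) volume) {ψ : ℝ → ℝ³ → ℝ³}
    (hψ : IsSpaceTimeTestOn (parabolicCylinderOpens R z) ψ) :
    ∫ w in parabolicCylinder R z, ⟪u w.1 w.2, convect (u w.1) (ψ w.1) w.2⟫ =
      -∫ w in parabolicCylinder R z, ⟪G w.1 w.2 (u w.1 w.2), ψ w.1 w.2⟫ := by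
  set I : Set ℝ := Ioo (z.1 - R ^ 2) z.1 with hI
  set B : Set ℝ³ := ball z.2 R with hB
  have hS : parabolicCylinder R z = I ×ˢ B := rfl
  have hSm : MeasurableSet (parabolicCylinder R z) := (isOpen_parabolicCylinder R z).measurableSet
  have hF₁ := integrableOn_inner_convect hNS.1 hM hψ
  have hF₂ := integrableOn_inner_gradient_apply hNS.1 hM hGI hψ
  -- slice data for a.e. `t`
  have hslice : ∀ᵐ t ∂(volume.restrict I),
      HasWeakFDerivOn (⟨B, isOpen_ball⟩ : Opens ℝ³) volume (u t) (G t) ∧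
      (∀ᵐ x ∂(volume.restrict B), ‖u t x‖ ≤ M) ∧
      IntegrableOn (G t) B volume ∧
      (∀ᵐ x ∂(volume.restrict B), ∑ j, G t x (𝐞 j) j = 0) := by
    have h1 := hG.ae_hasWeakFDerivOn_ball
    have h2 : ∀ᵐ t ∂(volume.restrict I), ∀ᵐ x ∂(volume.restrict B), ‖u t x‖ ≤ M :=
      ae_ae_of_ae_restrict_prod (P := fun w => ‖u w.1 w.2‖ ≤ M) hM
    have h3 : ∀ᵐ t ∂(volume.restrict I), IntegrableOn (G t) B volume := by
      have h := hGI
      rw [IntegrableOn, hS, Measure.volume_eq_prod, ← Measure.prod_restrict] at h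
      exact h.prod_right_ae
    have h4 : ∀ᵐ t ∂(volume.restrict I), ∀ᵐ x ∂(volume.restrict B), ∑ j, G t x (𝐞 j) j = 0 := by
      have h := ae_trace_eq_zero hNS hG
      have h' : ∀ᵐ w ∂(volume.restrict (parabolicCylinder R z)), ∑ j, G w.1 w.2 (𝐞 j) j = 0 :=
        (ae_restrict_iff' hSm).2 h
      exact ae_ae_of_ae_restrict_prod (P := fun w => ∑ j, G w.1 w.2 (𝐞 j) j = 0) h'
    filter_upwards [h1, h2, h3, h4] with t ht1 ht2 ht3 ht4
    exact ⟨ht1, ht2, ht3, ht4⟩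
  -- the slice identities
  have hsl : ∀ᵐ t ∂(volume.restrict I),
      ∫ x in B, ⟪u t x, convect (u t) (ψ t) x⟫ = -∫ x in B, ⟪G t x (u t x), ψ t x⟫ := by
    filter_upwards [hslice] with t ht
    exact setIntegral_inner_fderiv_apply_self_eq_neg ht.1 hM0 ht.2.1 ht.2.2.1 ht.2.2.2
      (isTestFunctionOn_slice_of_parabolicCylinder hψ t)
  -- Fubini
  have hprod : (volume.restrict (parabolicCylinder R z) : Measure (ℝ × ℝ³)) =
      (volume.restrict I).prod (volume.restrict B) := by
    rw [hS, Measure.volume_eq_prod, Measure.prod_restrict]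
  have e1 : ∫ w in parabolicCylinder R z, ⟪u w.1 w.2, convect (u w.1) (ψ w.1) w.2⟫ =
      ∫ t in I, ∫ x in B, ⟪u t x, convect (u t) (ψ t) x⟫ := by
    rw [hprod, integral_prod _ (hprod ▸ hF₁)]
  have e2 : ∫ w in parabolicCylinder R z, ⟪G w.1 w.2 (u w.1 w.2), ψ w.1 w.2⟫ =
      ∫ t in I, ∫ x in B, ⟪G t x (u t x), ψ t x⟫ := by
    rw [hprod, integral_prod _ (hprod ▸ hF₂)]
  rw [e1, e2, integral_congr_ae hsl, integral_neg]

/-- **Bounded distributional Navier–Stokes solutions with an integrable weak gradient solve the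
Stokes system with force `f = -(∇u) u`** (the identification of the distribution
`-div (u ⊗ u)` with the function `-(u·∇)u`; Seregin–Šverák 2009, §4 p. 11: "we can interpret the
pair `u^k` and `p^k` as a solution to the nonhomogeneous Stokes system (p12) … where
`f^k = -u^k·∇u^k`"): on a cylinder `Q = ]t₀-R², t₀[ × B(x₀, R)`, if `(u, p)` is a distributional
Navier–Stokes solution (`ν = 1`, no force) with `|u| ≤ M` a.e. and a weak spatial gradient
`G = ∇u` integrable on `Q`, then `(u, p)` is a distributional solution of the Stokes system with
force `-(G u)` (accepted `IsDistributionalStokesSolutionOn`).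
[cite: SereginSverak2009, §4 p. 11, (p12)] -/
theorem isDistributionalStokesSolutionOn_of_isDistributionalNSSolutionOn
    (hNS : IsDistributionalNSSolutionOn (parabolicCylinderOpens R z) 1 0 u p)
    (hG : HasWeakSpatialGradientOn (parabolicCylinderOpens R z) u G) (hM0 : 0 ≤ M)
    (hM : ∀ᵐ w ∂(volume.restrict (parabolicCylinder R z)), ‖u w.1 w.2‖ ≤ M)
    (hGI : IntegrableOn (uncurry G) (parabolicCylinder R z) volume) :
    IsDistributionalStokesSolutionOn (parabolicCylinderOpens R z) (fun t x => -(G t x (u t x)))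
      u p := by
  have hSm : MeasurableSet (parabolicCylinder R z) := (isOpen_parabolicCylinder R z).measurableSet
  have hum : AEStronglyMeasurable (uncurry u) (volume.restrict (parabolicCylinder R z)) :=
    hNS.1.aestronglyMeasurable
  -- the force is integrable on the cylinder
  have hfI : IntegrableOn (fun w : ℝ × ℝ³ => -(G w.1 w.2 (u w.1 w.2))) (parabolicCylinder R z)
      volume := by
    refine (Integrable.mono' (hGI.norm.mul_const M)
      (aestronglyMeasurable_clm_apply_fin3 hGI.aestronglyMeasurable hum) ?_).neg
    filter_upwards [hM] with w hw
    exact (ContinuousLinearMap.le_opNorm _ _).trans (mul_le_mul_of_nonneg_left hw (norm_nonneg _))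
  refine ⟨hNS.1, hNS.2.2.1, hfI.locallyIntegrableOn, hNS.2.2.2.1, fun ψ hψ => ?_⟩
  -- the pieces of the two integrands
  have hKc : IsCompact (tsupport (uncurry ψ)) := hψ.hasCompactSupport
  have hKQ : tsupport (uncurry ψ) ⊆ parabolicCylinder R z := hψ.tsupport_subset
  -- weights vanishing off `K = tsupport ψ` have compact support inside the cylinder
  have hsupp : ∀ {Ψ : ℝ × ℝ³ → ℝ³}, (∀ w ∉ tsupport (uncurry ψ), Ψ w = 0) →
      HasCompactSupport Ψ ∧ tsupport Ψ ⊆ parabolicCylinder R z := fun h0 =>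
    ⟨HasCompactSupport.intro hKc h0,
      (closure_minimal (support_subset_iff'.2 h0) hKc.isClosed).trans hKQ⟩
  have hsupp' : ∀ {θ : ℝ × ℝ³ → ℝ}, (∀ w ∉ tsupport (uncurry ψ), θ w = 0) →
      HasCompactSupport θ ∧ tsupport θ ⊆ parabolicCylinder R z := fun h0 =>
    ⟨HasCompactSupport.intro hKc h0,
      (closure_minimal (support_subset_iff'.2 h0) hKc.isClosed).trans hKQ⟩
  have h0A : ∀ w ∉ tsupport (uncurry ψ), uncurry (timeDeriv ψ) w = 0 := fun w hw =>
    timeDeriv_eq_zero_off_tsupport hw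
  have h0B : ∀ w ∉ tsupport (uncurry ψ), (fun w : ℝ × ℝ³ => Δ (ψ w.1) w.2) w = 0 := fun w hw =>
    laplacian_eq_zero_of_notMem_tsupport (notMem_tsupport_slice_of_notMem hw)
  have h0C : ∀ w ∉ tsupport (uncurry ψ),
      (fun w : ℝ × ℝ³ => VectorCalculus.divergence (ψ w.1) w.2) w = 0 := fun w hw =>
    divergence_eq_zero_of_notMem_tsupport (notMem_tsupport_slice_of_notMem hw)
  have hA : IntegrableOn (fun w : ℝ × ℝ³ => ⟪u w.1 w.2, timeDeriv ψ w.1 w.2⟫)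
      (parabolicCylinder R z) volume :=
    integrableOn_inner_of_tsupport_subset (Q := parabolicCylinderOpens R z)
      (Ψ := uncurry (timeDeriv ψ)) hNS.1 hψ.continuous_timeDeriv (hsupp h0A).1 (hsupp h0A).2
  have hB : IntegrableOn (fun w : ℝ × ℝ³ => ⟪u w.1 w.2, Δ (ψ w.1) w.2⟫)
      (parabolicCylinder R z) volume :=
    integrableOn_inner_of_tsupport_subset (Q := parabolicCylinderOpens R z)
      (Ψ := fun w => Δ (ψ w.1) w.2) hNS.1 hψ.continuous_laplacian_slice (hsupp h0B).1
      (hsupp h0B).2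
  have hC : IntegrableOn (fun w : ℝ × ℝ³ => p w.1 w.2 * VectorCalculus.divergence (ψ w.1) w.2)
      (parabolicCylinder R z) volume :=
    integrableOn_mul_of_tsupport_subset (Q := parabolicCylinderOpens R z) (q := uncurry p)
      (θ := fun w => VectorCalculus.divergence (ψ w.1) w.2) hNS.2.2.1
      hψ.continuous_divergence_slice (hsupp' h0C).1 (hsupp' h0C).2
  have hF₁ := integrableOn_inner_convect hNS.1 hM hψ
  have hF₂ := integrableOn_inner_gradient_apply hNS.1 hM hGI hψ
  have hF12 : IntegrableOn (fun w : ℝ × ℝ³ => ⟪u w.1 w.2, convect (u w.1) (ψ w.1) w.2⟫ +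
      ⟪G w.1 w.2 (u w.1 w.2), ψ w.1 w.2⟫) (parabolicCylinder R z) volume := hF₁.add hF₂
  have key := setIntegral_inner_convect_eq_neg hNS hG hM0 hM hGI hψ
  have hNSψ := hNS.2.2.2.2 ψ hψ
  rw [coe_parabolicCylinderOpens] at hNSψ ⊢
  -- the Navier–Stokes integrand is integrable
  have hNSint : IntegrableOn (fun w : ℝ × ℝ³ => ⟪u w.1 w.2, timeDeriv ψ w.1 w.2⟫ +
      ⟪u w.1 w.2, convect (u w.1) (ψ w.1) w.2⟫ + 1 * ⟪u w.1 w.2, Δ (ψ w.1) w.2⟫ +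
      p w.1 w.2 * VectorCalculus.divergence (ψ w.1) w.2 +
      ⟪(0 : ℝ → ℝ³ → ℝ³) w.1 w.2, ψ w.1 w.2⟫) (parabolicCylinder R z) volume := by
    have h := ((hA.add hF₁).add (hB.const_mul 1)).add hC
    refine h.congr_fun (fun w _ => ?_) hSm
    simp
  -- compare the two integrands
  have hsplit : ∫ w in parabolicCylinder R z, (⟪u w.1 w.2, timeDeriv ψ w.1 w.2⟫ +
        ⟪u w.1 w.2, Δ (ψ w.1) w.2⟫ + p w.1 w.2 * VectorCalculus.divergence (ψ w.1) w.2 +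
        ⟪(fun t x => -(G t x (u t x))) w.1 w.2, ψ w.1 w.2⟫) =
      (∫ w in parabolicCylinder R z, (⟪u w.1 w.2, timeDeriv ψ w.1 w.2⟫ +
        ⟪u w.1 w.2, convect (u w.1) (ψ w.1) w.2⟫ + 1 * ⟪u w.1 w.2, Δ (ψ w.1) w.2⟫ +
        p w.1 w.2 * VectorCalculus.divergence (ψ w.1) w.2 +
        ⟪(0 : ℝ → ℝ³ → ℝ³) w.1 w.2, ψ w.1 w.2⟫)) -
      ∫ w in parabolicCylinder R z, (⟪u w.1 w.2, convect (u w.1) (ψ w.1) w.2⟫ +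
        ⟪G w.1 w.2 (u w.1 w.2), ψ w.1 w.2⟫) := by
    rw [← integral_sub hNSint hF12]
    refine setIntegral_congr_fun hSm fun w _ => ?_
    simp only [Pi.zero_apply, inner_zero_left, add_zero, one_mul, inner_neg_left]
    ring
  rw [hsplit, hNSψ, integral_add hF₁ hF₂, key]
  ring

end ConvSpaceTime

end Literature.Analysis.FluidPDE
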